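import Mathlib
import HarnessLib
import Summits.NavierStokesRegularity.NavierStokesRegularity.Theorems.TaylorModelRungThreeCertificateFormatVGrowth2Run

/-!
# Crux K1b-DR (stmt-NavierStokesRegularity-23954), line `taylor-model` — TWO-LEVEL growth checker (variant B), SOUNDNESS part 2:
# block composition, claims, every pair tested, (R3); the transport legs (tm-g4 g4)

`kerOf_kiter_add` / `matOfKer_kerOf_kiter_add` (block composition of product kernels), **`memMat_PchM`** (the block-bracketed
chunk product encloses the chunk chain), **`claims2_sound`** (`|PchM| ≤ T̃_q`, `vIn a … ≤ ũ_a`), `facts_at2`, `L1_bounds2`,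
**`pair_tested2`** (every pair `(a', b)` was tested with `gD2 a' b`: same sub-block / same chunk / earlier chunk / identity),
**`hR3a_of_growth2`**, **`hR3b_of_growth2`**; the generic legs of (R2): `leg_prod` (one product leg), `vSub_transport` (sub-block
legs), `init_leg` (a start's first leg). MODEL-lattice bookkeeping only (rung TL-M3); nothing here is a statement about the
Navier–Stokes equations.
-/

-- the sub-problem namespace repeats the summit name by design (D-0017)
set_option linter.dupNamespace false

namespace Summit.NavierStokesRegularity.NavierStokesRegularity.Theorems.TaylorModelCert

open scoped BigOperators
open Literature.Analysis.FluidPDE.TaoCascade Literature.Analysis.FluidPDE.TaoCascade.TaylorChain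
open Summit.NavierStokesRegularity.NavierStokesRegularity.Theorems.TaylorModelReadout
open Summit.NavierStokesRegularity.NavierStokesRegularity.Theorems.TaylorModelV

namespace CertTablesV

variable {TV : CertTablesV} {kitOf : ℕ → CoreKit} {wT : ℕ → Array Dyad} {sc : ScalarsV}

/-! ### Block composition of product kernels; `PchM` encloses the chunk chain -/

/-- **Block composition** (window rows): `kerOf (kiter A s₀ (m + n)) = kcomp (kerOf (kiter A (s₀+m) n)) (kerOf (kiter A s₀ m))`.
[folklore] -/
theorem kerOf_kiter_add {cd : CertData} (A : ℕ → Ker) (s₀ m n : ℕ) (i' : Fin 4) {k' : ℤ} (hk1' : -cd.Kb ≤ k') (hk2' : k' ≤ cd.Ka)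
    (i : Fin 4) (k : ℤ) :
    kerOf (kiter cd A s₀ (m + n)) i' k' i k = kcomp cd (kerOf (kiter cd A (s₀ + m) n)) (kerOf (kiter cd A s₀ m)) i' k' i k := by
  show kiter cd A s₀ (m + n) (basisSt i k) i' k' = _
  rw [kiter_add, kiter_eq_kapp_kerOf A (s₀ + m) n _ i' hk1' hk2', kapp_apply_of_InW _ _ i' ⟨hk1', hk2'⟩]
  rfl

/-- Block composition in coordinates. [folklore] -/
theorem matOfKer_kerOf_kiter_add (A : ℕ → Ker) (s₀ m n' : ℕ) {r : ℕ} (hr : r < TV.base.n) (c : ℕ) :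
    TV.base.matOfKer (kerOf (kiter (TV.toCertDataVW kitOf wT sc) A s₀ (m + n'))) r c =
      ∑ t ∈ Finset.range TV.base.n, TV.base.matOfKer (kerOf (kiter (TV.toCertDataVW kitOf wT sc) A (s₀ + m) n')) r t *
        TV.base.matOfKer (kerOf (kiter (TV.toCertDataVW kitOf wT sc) A s₀ m)) t c := by
  have hkr := TV.base.InW_wk hr
  simp only [CertTables.matOfKer]
  rw [kerOf_kiter_add A s₀ m n' (TV.base.wi r) (by rw [cd_Kb]; exact hkr.1) (by rw [cd_Ka]; exact hkr.2)]
  exact TV.base.sum_nW_eq_sum_range _ cd_Kb cd_Ka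
    (fun i k => kerOf (kiter _ A (s₀ + m) n') (TV.base.wi r) (TV.base.wk r) i k * kerOf (kiter _ A s₀ m) i k (TV.base.wi c) (TV.base.wk c))

/-- **`PchM` encloses the chain over the sub-blocks accumulated so far**: admissible on `[C, C + kℓ)` ⇒ the product matrix of
`kiter Ac C (kℓ)` lies in `PchM C k` (`k ≥ 1`). [folklore] -/
theorem memMat_PchM {j ℓ C : ℕ} {Ac : ℕ → Ker} :
    ∀ k : ℕ, 1 ≤ k → (∀ s', C ≤ s' → s' < C + k * ℓ →
        KerMem (TV.toCertDataVW kitOf wT sc) (Ac s') ((TV.toBoxesW kitOf wT).Mlo j s') ((TV.toBoxesW kitOf wT).Mhi j s')) →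
      MemMat TV.base.n (TV.base.matOfKer (kerOf (kiter (TV.toCertDataVW kitOf wT sc) Ac C (k * ℓ)))) (TV.PchM kitOf wT j ℓ C k)
  | 0, h, _ => absurd h (by omega)
  | 1, _, hA => by
    show MemMat TV.base.n _ (TV.prodM kitOf wT j C ℓ)
    rw [one_mul]
    exact memMat_prodM (sc := sc) ℓ fun s' h1 h2 => hA s' h1 (by omega)
  | k + 2, _, hA => by
    show MemMat TV.base.n _ (mulII TV.base.n TV.prec (TV.prodM kitOf wT j (C + (k + 1) * ℓ) ℓ) (TV.PchM kitOf wT j ℓ C (k + 1)))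
    have ih := memMat_PchM (k + 1) (by omega) (fun s' h1 h2 => hA s' h1 (by nlinarith))
    have hlast := memMat_prodM (sc := sc) (j := j) (a := C + (k + 1) * ℓ) (A := Ac) ℓ fun s' h1 h2 =>
      hA s' (by omega) (by nlinarith)
    intro r hr c hc
    rw [show (k + 2) * ℓ = (k + 1) * ℓ + ℓ by ring, matOfKer_kerOf_kiter_add (sc := sc) Ac C ((k + 1) * ℓ) ℓ hr c]
    exact memMat_mulII TV.prec hlast ih r hr c hc

section Claims

variable {j L ℓ q : ℕ} (hℓ : 0 < ℓ) (hdvd : ℓ ∣ L)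
include hℓ hdvd

/-- **The claims of the two-level pass, unpacked** (when a later chunk exists): `|PchM (qL) (L/ℓ)| ≤ T̃_q` entrywise and
`vIn a (((q+1)L − (a/ℓ+1)ℓ)/ℓ) ≤ ũ_a` coordinatewise for every start `a` of chunk `q`. [folklore] -/
theorem claims2_sound {P : ℕ → CoreOut → Bool} (h : TV.growthRange2 kitOf wT P j L ℓ q = true) (hL : 0 < L)
    (hlater : (q + 1) * L < TV.S j) :
    (∀ r < TV.base.n, ∀ c < TV.base.n, dre (magM TV.base.n (TV.PchM kitOf wT j ℓ (q * L) (L / ℓ))) r c ≤ dre (TV.gT j q) r c) ∧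
    (∀ a, q * L ≤ a → a < (q + 1) * L → ∀ c < TV.base.n,
        vre (TV.vIn kitOf wT j ℓ a (((q + 1) * L - (a / ℓ + 1) * ℓ) / ℓ)) c ≤ vre (TV.gU j a) c) := by
  obtain ⟨-, stF, hI, hcl⟩ := growthRange2_sound (TV := TV) (kitOf := kitOf) (wT := wT) hℓ hdvd h
  have hend : (q + 1) * L = q * L + L := by ring
  have hmin : min L (TV.S j - q * L) = L := min_eq_left (by omega)
  rw [hmin] at hI hcl
  obtain ⟨-, -, h3, h4, -, -, h7⟩ := hI
  have hgE : (q * L + L) / ℓ * ℓ = q * L + L := Nat.div_mul_cancel (by rw [← hend]; exact Dvd.dvd.mul_left hdvd _)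
  rw [hgE] at h3 h4 h7
  unfold GCtx.claims2 at hcl
  simp only [gctx_S, gctx_n, gctx_q, gctx_L, Bool.or_eq_true, decide_eq_true_eq, Bool.and_eq_true, allN_eq_true] at hcl
  rcases hcl with hle | ⟨hT, hU⟩
  · exfalso; omega
  have hPch := h7 (by omega)
  have hLd : (q * L + L - q * L) / ℓ = L / ℓ := by rw [show q * L + L - q * L = L by omega]
  constructor
  · intro r hr c hc
    have := le_of_leMatD hT hr hc
    rw [hPch, hLd] at this
    exact this
  · intro a ha1 ha2 c hc
    have hi : a - q * L < stF.Uin.size := by rw [h3]; omega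
    have e0 := h4 (a - q * L) hi
    have e1 : q * L + (a - q * L) = a := by omega
    rw [e1] at e0
    have := le_of_leVec (hU (a - q * L) hi) hc
    rw [e0, ← hend] at this
    have e2 : (TV.gctx j L q).U (q * L + (a - q * L)) = TV.gU j a := by rw [e1]; rfl
    rw [e2] at this
    exact this

end Claims

/-! ### From the two-level Booleans to (R3) and (R2) -/

section Stage2

variable {P : ℕ → CoreOut → Bool} {j L ℓ : ℕ} (hℓ : 0 < ℓ) (hdvd : ℓ ∣ L) (hL : 0 < L)
  (hGR : ∀ q, q * L < TV.S j → TV.growthRange2 kitOf wT P j L ℓ q = true)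
include hℓ hdvd hL hGR

/-- The run facts AT sub-step `t < S` (chunk `t/L`, grid start `t/ℓ·ℓ`). [folklore] -/
theorem facts_at2 {t : ℕ} (ht : t < TV.S j) :
    ((TV.ctxOfW kitOf wT j).subStep t ((TV.ctxOfW kitOf wT j).nodeAt t)).ok = true ∧
    P t ((TV.ctxOfW kitOf wT j).subStep t ((TV.ctxOfW kitOf wT j).nodeAt t)).core = true ∧
    (Dyad.ble Dyad.zero (TV.coreVW kitOf wT j t).L1 = true ∧ Dyad.ble (TV.coreVW kitOf wT j t).L1 (dget (TV.gL1 j) t) = true) ∧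
    (∀ i', i' < t + 1 - t / ℓ * ℓ → (TV.gctx j L (t / L)).pairTest (t / ℓ * ℓ + i') (t + 1)
      ((TV.gctx j L (t / L)).facOf (TV.prodM kitOf wT j (t / ℓ * ℓ + i') (t + 1 - (t / ℓ * ℓ + i'))) (TV.ωhiV j)) = true) ∧
    (TV.gctx j L (t / L)).pairTest (t + 1) (t + 1) ((TV.gctx j L (t / L)).facOf (idIM TV.base.n) (TV.ωhiV j)) = true ∧
    (∀ i', i' < t / ℓ * ℓ - t / L * L → (TV.gctx j L (t / L)).pairTest (t / L * L + i') (t + 1)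
      ((TV.gctx j L (t / L)).facOf (TV.prodM kitOf wT j (t / ℓ * ℓ) (t + 1 - t / ℓ * ℓ))
        (TV.vIn kitOf wT j ℓ (t / L * L + i') ((t / ℓ * ℓ - ((t / L * L + i') / ℓ + 1) * ℓ) / ℓ))) = true) ∧
    (∀ a' < t / L * L, (TV.gctx j L (t / L)).pairTest a' (t + 1)
      ((TV.gctx j L (t / L)).facOf (TV.prodM kitOf wT j (t / ℓ * ℓ) (t + 1 - t / ℓ * ℓ))
        (TV.vOut kitOf wT j L ℓ a' (t / L) ((t / ℓ * ℓ - t / L * L) / ℓ))) = true) := by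
  have h1 : t / L * L ≤ t := Nat.div_mul_le_self t L
  have h2 : t < t / L * L + L := Nat.lt_div_mul_add hL
  have hq : t / L * L < TV.S j := lt_of_le_of_lt h1 ht
  have hi : t - t / L * L < min L (TV.S j - t / L * L) := by apply lt_min <;> omega
  have h := (growthRange2_sound (TV := TV) (kitOf := kitOf) (wT := wT) hℓ hdvd (hGR (t / L) hq)).1 (t - t / L * L) hi
  have e : t / L * L + (t - t / L * L) = t := by omega
  rw [e] at h
  exact h

/-- `L1_t ≤ gL1[t]` and `0 ≤ L1_t` for all `t < S` (two-level runs). [folklore] -/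
theorem L1_bounds2 : ∀ t, t < TV.S j →
    ((TV.coreVW kitOf wT j t).L1).toReal ≤ (dget (TV.gL1 j) t).toReal ∧ 0 ≤ ((TV.coreVW kitOf wT j t).L1).toReal := by
  intro t ht
  obtain ⟨-, -, ⟨h0, h1⟩, -⟩ := facts_at2 (TV := TV) (kitOf := kitOf) (wT := wT) hℓ hdvd hL hGR ht
  have h0' := (Dyad.ble_iff _ _).1 h0
  rw [Dyad.toReal_zero] at h0'
  exact ⟨(Dyad.ble_iff _ _).1 h1, h0'⟩

/-- **Every pair `(a', b)` was tested with the factor `gD2 a' b`.** [folklore] -/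
theorem pair_tested2 {a' b : ℕ} (hb1 : 1 ≤ b) (hbS : b ≤ TV.S j) (hab : a' ≤ b) :
    (TV.gctx j L ((b - 1) / L)).pairTest a' b (TV.gD2 kitOf wT j L ℓ a' b) = true := by
  have ht : b - 1 < TV.S j := by omega
  obtain ⟨-, -, -, hIn, hDiag, hMid, hOut⟩ := facts_at2 (TV := TV) (kitOf := kitOf) (wT := wT) hℓ hdvd hL hGR ht
  set qb := (b - 1) / L with hqb
  set g := (b - 1) / ℓ * ℓ with hgd
  have hC1 : qb * L ≤ b - 1 := Nat.div_mul_le_self _ L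
  have hC2 : b - 1 < qb * L + L := Nat.lt_div_mul_add hL
  have hg1 : g ≤ b - 1 := Nat.div_mul_le_self _ ℓ
  have hg2 : b - 1 < g + ℓ := Nat.lt_div_mul_add hℓ
  have hCg : qb * L ≤ g := chunk_le_grid hdvd hC1
  have eb : b - 1 + 1 = b := by omega
  rw [eb] at hIn hDiag hMid hOut
  rcases Nat.lt_or_ge a' (qb * L) with hlt | hge
  · -- start in an earlier chunk
    have h := hOut a' hlt
    have hn1 : ¬ b ≤ (a' / ℓ + 1) * ℓ := by
      have hd : a' / ℓ < (b - 1) / ℓ := by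
        apply (Nat.div_lt_iff_lt_mul hℓ).2
        calc a' < qb * L := hlt
          _ ≤ g := hCg
          _ = (b - 1) / ℓ * ℓ := hgd
      have hm : (a' / ℓ + 1) * ℓ ≤ (b - 1) / ℓ * ℓ := Nat.mul_le_mul_right ℓ hd
      rw [← hgd] at hm
      omega
    have hn2 : ¬ b ≤ (a' / L + 1) * L := by
      have hd : a' / L < qb := (Nat.div_lt_iff_lt_mul hL).2 hlt
      have hm : (a' / L + 1) * L ≤ qb * L := Nat.mul_le_mul_right L hd
      omega
    unfold gD2
    rw [if_neg hn1]
    simp only []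
    rw [if_neg hn2]
    exact h
  · rcases Nat.lt_or_ge a' g with hltg | hgeg
    · -- start earlier in the same chunk
      have hi' : a' - qb * L < g - qb * L := by omega
      have h := hMid (a' - qb * L) hi'
      have e1 : qb * L + (a' - qb * L) = a' := by omega
      rw [e1] at h
      have hn1 : ¬ b ≤ (a' / ℓ + 1) * ℓ := by
        have hd : a' / ℓ < (b - 1) / ℓ := (Nat.div_lt_iff_lt_mul hℓ).2 (by rw [← hgd]; exact hltg)
        have hm : (a' / ℓ + 1) * ℓ ≤ (b - 1) / ℓ * ℓ := Nat.mul_le_mul_right ℓ hd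
        rw [← hgd] at hm
        omega
      have hdivL : a' / L = qb := div_eq_of_chunk hL hge (by omega)
      have hy2 : b ≤ (a' / L + 1) * L := by rw [hdivL]; linarith
      unfold gD2
      rw [if_neg hn1]
      simp only []
      rw [if_pos hy2, hdivL]
      exact h
    · rcases Nat.lt_or_ge a' b with hltb | hgeb
      · -- start in the same sub-block
        have hi' : a' - g < b - g := by omega
        have h := hIn (a' - g) hi'
        have e1 : g + (a' - g) = a' := by omega
        rw [e1] at h
        have hdiv : a' / ℓ = (b - 1) / ℓ := div_eq_of_chunk hℓ (by rw [← hgd]; exact hgeg) (by rw [← hgd]; omega)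
        have hpos : b ≤ (a' / ℓ + 1) * ℓ := by
          rw [hdiv, add_mul, one_mul, ← hgd]; omega
        have hdivL : a' / L = qb := div_eq_of_chunk hL (by omega) (by omega)
        unfold gD2
        rw [if_pos hpos, hdivL]
        exact h
      · -- `a' = b`
        have hab' : a' = b := le_antisymm hab hgeb
        subst hab'
        have hpos : a' ≤ (a' / ℓ + 1) * ℓ := by have := Nat.lt_div_mul_add (a := a') hℓ; linarith
        unfold gD2
        rw [if_pos hpos, Nat.sub_self, facOf_gctx j L (a' / L) qb]
        exact hDiag

omit hℓ hdvd hL hGR in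
/-- `0 ≤ gD2`. [folklore] -/
theorem gD2_nonneg (a b : ℕ) : 0 ≤ (TV.gD2 kitOf wT j L ℓ a b).toReal := by
  unfold gD2; split_ifs <;> exact GCtx.facOf_nonneg _ _ _

/-- **(R3a) from the two-level Booleans.** [folklore] -/
theorem hR3a_of_growth2 (a b : ℕ) (ha : a < TV.S j) (hab : a + 1 ≤ b) (hb : b ≤ TV.S j) :
    (TV.toCertDataVW kitOf wT sc).L1 j a * TV.Gr2 kitOf wT j L ℓ (a + 1) b ≤ TV.ΛTr j ∧
    (b < TV.S j → (TV.toCertDataVW kitOf wT sc).L1 j a * TV.Gr2 kitOf wT j L ℓ (a + 1) b *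
      (TV.toCertDataVW kitOf wT sc).L1 j b ≤ (TV.toCertDataVW kitOf wT sc).Λ j) := by
  have hpt := pair_tested2 (TV := TV) (kitOf := kitOf) (wT := wT) hℓ hdvd hL hGR (a' := a + 1) (b := b) (by omega) hb hab
  have hgb : b < TV.S j → 0 ≤ (dget (TV.gL1 j) b).toReal := fun hb' =>
    (L1_bounds2 (TV := TV) (kitOf := kitOf) (wT := wT) hℓ hdvd hL hGR b hb').2.trans (L1_bounds2 hℓ hdvd hL hGR b hb').1
  obtain ⟨h1, h2⟩ := pairTest_sound (TV := TV) hpt (by omega) hgb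
  simp only [Nat.add_sub_cancel] at h1 h2
  obtain ⟨hL1a, hL1a0⟩ := L1_bounds2 (TV := TV) (kitOf := kitOf) (wT := wT) hℓ hdvd hL hGR a ha
  have hG0 := gD2_nonneg (TV := TV) (kitOf := kitOf) (wT := wT) (j := j) (L := L) (ℓ := ℓ) (a + 1) b
  have hΛdes : ((IntervalD.ofQS2 TV.prec (TV.stageV j).Λdes).lo).toReal ≤ TV.ΛTr j := (IntervalD.mem_ofQS2 TV.prec _).1
  have hΛ : ((IntervalD.ofQS2 TV.prec (TV.base.stage j).Λ).lo).toReal ≤ (TV.toCertDataVW kitOf wT sc).Λ j :=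
    (IntervalD.mem_ofQS2 TV.prec _).1
  rw [cd_L1]
  unfold Gr2
  constructor
  · calc ((TV.coreVW kitOf wT j a).L1).toReal * (TV.gD2 kitOf wT j L ℓ (a + 1) b).toReal
        ≤ (dget (TV.gL1 j) a).toReal * (TV.gD2 kitOf wT j L ℓ (a + 1) b).toReal := mul_le_mul_of_nonneg_right hL1a hG0
      _ ≤ _ := h1.trans hΛdes
  · intro hb'
    obtain ⟨hL1b, hL1b0⟩ := L1_bounds2 (TV := TV) (kitOf := kitOf) (wT := wT) hℓ hdvd hL hGR b hb'
    rw [cd_L1]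
    calc ((TV.coreVW kitOf wT j a).L1).toReal * (TV.gD2 kitOf wT j L ℓ (a + 1) b).toReal * ((TV.coreVW kitOf wT j b).L1).toReal
        ≤ (dget (TV.gL1 j) a).toReal * (TV.gD2 kitOf wT j L ℓ (a + 1) b).toReal * (dget (TV.gL1 j) b).toReal :=
          mul_le_mul (mul_le_mul_of_nonneg_right hL1a hG0) hL1b hL1b0 (mul_nonneg (hL1a0.trans hL1a) hG0)
      _ ≤ _ := (h2 hb').trans hΛ

/-- **(R3b) from `checkL1` and the two-level Booleans** (all `a < S`). [folklore] -/
theorem hR3b_of_growth2 (hcL : TV.checkL1 j = true) :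
    ∀ a, a < TV.S j → (TV.toCertDataVW kitOf wT sc).L1 j a ≤ (TV.toCertDataVW kitOf wT sc).Λ j := by
  intro a ha
  unfold checkL1 at hcL
  simp only [Bool.and_eq_true, allN_eq_true, decide_eq_true_eq] at hcL
  have h := (Dyad.ble_iff _ _).1 (hcL.2 a ha)
  have hΛ : ((IntervalD.ofQS2 TV.prec (TV.base.stage j).Λ).lo).toReal ≤ (TV.toCertDataVW kitOf wT sc).Λ j :=
    (IntervalD.mem_ofQS2 TV.prec _).1
  rw [cd_L1]
  exact ((L1_bounds2 (TV := TV) (kitOf := kitOf) (wT := wT) hℓ hdvd hL hGR a ha).1.trans h).trans hΛ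

/-! ### (R2) for the two-level variant -/

variable (hω : ∀ k, 0 < (TV.toCertDataVW kitOf wT sc).ω j k)
include hω

omit hℓ hdvd hL hGR hω in
/-- **ONE LEG**: a chain bounded by `r·w` at the grid point `g` is bounded by `r·(|prodM g n|·w)↑` at `g + n`. [folklore] -/
theorem leg_prod {s₀ g n' : ℕ} (hs : s₀ ≤ g) {Ac : ℕ → Ker}
    (hA : ∀ s', g ≤ s' → s' < g + n' →
      KerMem (TV.toCertDataVW kitOf wT sc) (Ac s') ((TV.toBoxesW kitOf wT).Mlo j s') ((TV.toBoxesW kitOf wT).Mhi j s'))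
    {v : Fin 4 → ℤ → ℝ} {r : ℝ} (hr : 0 ≤ r) {w : Array Dyad}
    (hw : AbsLeW (TV.toCertDataVW kitOf wT sc) (kiter (TV.toCertDataVW kitOf wT sc) Ac s₀ (g - s₀) v)
      (fun i k => r * vre w (TV.base.idx i k))) :
    AbsLeW (TV.toCertDataVW kitOf wT sc) (kiter (TV.toCertDataVW kitOf wT sc) Ac s₀ (g + n' - s₀) v)
      (fun i k => r * vre (absMulVecUp TV.base.n TV.prec (magM TV.base.n (TV.prodM kitOf wT j g n')) w) (TV.base.idx i k)) := by
  rw [show g + n' - s₀ = (g - s₀) + n' by omega, kiter_add, show s₀ + (g - s₀) = g by omega]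
  have hmem := memMat_prodM (sc := sc) (j := j) (a := g) (A := Ac) n' hA
  have hK := TV.base.kerMem_of_memMat_kiter cd_Kb cd_Ka hmem
  have hb := absLeW_kiter_of_prodMem hK hw
  intro i' k' hk1' hk2'
  refine (hb i' k' hk1' hk2').trans ?_
  have hrow : ∀ r' < TV.base.n, ∑ t ∈ Finset.range TV.base.n,
      (IntervalD.mag (imget (TV.prodM kitOf wT j g n') r' t)).toReal * (r * vre w t) ≤
      r * vre (absMulVecUp TV.base.n TV.prec (magM TV.base.n (TV.prodM kitOf wT j g n')) w) r' := by
    intro r' hr'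
    have e : ∑ t ∈ Finset.range TV.base.n, (IntervalD.mag (imget (TV.prodM kitOf wT j g n') r' t)).toReal * (r * vre w t) =
        r * ∑ t ∈ Finset.range TV.base.n, (IntervalD.mag (imget (TV.prodM kitOf wT j g n') r' t)).toReal * vre w t := by
      rw [Finset.mul_sum]; exact Finset.sum_congr rfl fun t _ => by ring
    rw [e]
    exact mul_le_mul_of_nonneg_left
      (sum_le_absMulVecUp TV.prec (fun r hr t ht => by rw [dre_magM (TV.prodM kitOf wT j g n') hr ht]) hr') hr
  exact TV.base.rowsum_window_le_of_coord cd_Kb cd_Ka (TV.prodM kitOf wT j g n') (fun t => r * vre w t)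
    (fun r' => r * vre (absMulVecUp TV.base.n TV.prec (magM TV.base.n (TV.prodM kitOf wT j g n')) w) r') hrow i' hk1' hk2'

omit hℓ hdvd hL hGR hω in
/-- **SUB-BLOCK TRANSPORT**: `m` legs of length `ℓ` from the grid point `g` (the vector `vSub g w m`). [folklore] -/
theorem vSub_transport {s₀ g : ℕ} (hs : s₀ ≤ g) {v : Fin 4 → ℤ → ℝ} {r : ℝ} (hr : 0 ≤ r) (w : Array Dyad) :
    ∀ m : ℕ, ∀ Ac : ℕ → Ker, (∀ s', g ≤ s' → s' < g + m * ℓ →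
      KerMem (TV.toCertDataVW kitOf wT sc) (Ac s') ((TV.toBoxesW kitOf wT).Mlo j s') ((TV.toBoxesW kitOf wT).Mhi j s')) →
      AbsLeW (TV.toCertDataVW kitOf wT sc) (kiter (TV.toCertDataVW kitOf wT sc) Ac s₀ (g - s₀) v)
        (fun i k => r * vre w (TV.base.idx i k)) →
      AbsLeW (TV.toCertDataVW kitOf wT sc) (kiter (TV.toCertDataVW kitOf wT sc) Ac s₀ (g + m * ℓ - s₀) v)
        (fun i k => r * vre (TV.vSub kitOf wT j ℓ g w m) (TV.base.idx i k))
  | 0, Ac, _, hw => by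
    simp only [Nat.zero_mul, Nat.add_zero]
    exact hw
  | m + 1, Ac, hA, hw => by
    have ih := vSub_transport hs hr w m Ac (fun s' h1 h2 => hA s' h1 (by nlinarith)) hw
    have hleg := leg_prod (sc := sc) (j := j) (s₀ := s₀) (g := g + m * ℓ) (n' := ℓ) (by omega) (Ac := Ac)
      (fun s' h1 h2 => hA s' (by omega) (by nlinarith)) hr ih
    rw [vSub_succ, show g + (m + 1) * ℓ - s₀ = g + m * ℓ + ℓ - s₀ by rw [add_mul, one_mul, Nat.add_assoc]]
    exact hleg

omit hℓ hdvd hL hGR hω in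
/-- **The first leg of a start `a`** (to its next grid point `g₀`): the `r·ω`-ball is bounded by `r·(|prodM a (g₀−a)|·ω↑)↑`.
[folklore] -/
theorem init_leg {a g₀ : ℕ} (hag : a ≤ g₀) {Ac : ℕ → Ker}
    (hA : ∀ s', a ≤ s' → s' < g₀ →
      KerMem (TV.toCertDataVW kitOf wT sc) (Ac s') ((TV.toBoxesW kitOf wT).Mlo j s') ((TV.toBoxesW kitOf wT).Mhi j s'))
    {v : Fin 4 → ℤ → ℝ} {r : ℝ} (hr : 0 ≤ r) (hv : (TV.toCertDataVW kitOf wT sc).InBall j v r) :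
    AbsLeW (TV.toCertDataVW kitOf wT sc) (kiter (TV.toCertDataVW kitOf wT sc) Ac a (g₀ - a) v)
      (fun i k => r * vre (absMulVecUp TV.base.n TV.prec (magM TV.base.n (TV.prodM kitOf wT j a (g₀ - a))) (TV.ωhiV j))
        (TV.base.idx i k)) := by
  set P := TV.prodM kitOf wT j a (g₀ - a) with hP
  have hmem := memMat_prodM (sc := sc) (j := j) (a := a) (A := Ac) (g₀ - a) fun s' h1 h2 => hA s' h1 (by omega)
  have hK := TV.base.kerMem_of_memMat_kiter cd_Kb cd_Ka hmem
  have hb := absLeW_kiter_of_prodMem hK (v := v) (b := fun i k => r * (TV.toCertDataVW kitOf wT sc).ω j k)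
    (fun i k hk1 hk2 => hv i k hk1 hk2)
  intro i' k' hk1' hk2'
  refine (hb i' k' hk1' hk2').trans ?_
  have hrow : ∀ r' < TV.base.n, ∑ t ∈ Finset.range TV.base.n,
      (IntervalD.mag (imget P r' t)).toReal * (r * (TV.toCertDataVW kitOf wT sc).ω j (TV.base.wk t)) ≤
      r * vre (absMulVecUp TV.base.n TV.prec (magM TV.base.n P) (TV.ωhiV j)) r' := by
    intro r' hr'
    have e : ∑ t ∈ Finset.range TV.base.n, (IntervalD.mag (imget P r' t)).toReal * (r * (TV.toCertDataVW kitOf wT sc).ω j (TV.base.wk t))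
        = r * ∑ t ∈ Finset.range TV.base.n, (IntervalD.mag (imget P r' t)).toReal * (TV.toCertDataVW kitOf wT sc).ω j (TV.base.wk t) := by
      rw [Finset.mul_sum]; exact Finset.sum_congr rfl fun t _ => by ring
    rw [e]
    refine mul_le_mul_of_nonneg_left ?_ hr
    exact (rowsum_omega_le_ωhi (sc := sc) (j := j) P hr').trans
      (sum_le_absMulVecUp TV.prec (fun r hr t ht => by rw [dre_magM P hr ht]) hr')
  have hw := TV.base.rowsum_window_le_of_coord cd_Kb cd_Ka P (fun t => r * (TV.toCertDataVW kitOf wT sc).ω j (TV.base.wk t))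
    (fun r' => r * vre (absMulVecUp TV.base.n TV.prec (magM TV.base.n P) (TV.ωhiV j)) r') hrow i' hk1' hk2'
  refine le_trans (le_of_eq (Finset.sum_congr rfl fun c _ => ?_)) hw
  rw [TV.base.wk_idx _ (by rw [← cd_Kb (TV := TV) (kitOf := kitOf) (wT := wT) (sc := sc),
    ← cd_Ka (TV := TV) (kitOf := kitOf) (wT := wT) (sc := sc)]; exact shellOf_mem _ c)]


end Stage2

end CertTablesV

end Summit.NavierStokesRegularity.NavierStokesRegularity.Theorems.TaylorModelCert
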